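import Summits.CriticalPhenomena.PercolationContinuityZ3.Theorems.PercNearOneGluingNoHeavyLowerTailSahiE3LroSlot
import Summits.CriticalPhenomena.PercolationContinuityZ3.Theorems.PercNearOneGluingNoHeavyLowerTailSahiE3MajSlot
import Literature.Combinatorics.Sahi2008.Percolation
import Literature.Probability.Percolation.LongRangeKernelPercolationProofs
import Mathlib.Data.Fin.VecNotation
import Mathlib.Tactic.FinCases
import HarnessLib
import HarnessLib.Audit

/-!
# `NoHeavyLowerTail` (crux stmt-CriticalPhenomena-4575), Sahi programme P4 (Holley / monotone coupling):
# KAHN'S CONJECTURE 5 FOR EVERY LINEAR READ-ONCE FIRST SLOT — the `prodBernoulli` form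

Support file (cell `prim-l12`, seat P4, generation 11; `--supports stmt-CriticalPhenomena-4575`).  No named facts, no sorries;
standard axioms; def-free.

THEOREM `kahn_of_lro`: for every finite index type `ι`, every `p : ι → [0,1]`, every injective `v : Fin (n+1) → ι`, every operator
list `ops : Fin n → Bool` (the linear read-once formula `x₀ ∘₀ (x₁ ∘₁ (⋯ ∘ₙ₋₁ xₙ))`, `∘ᵢ = ∨` iff `ops i`), `U'` its set of true
patterns, and ALL increasing events `A, B ⊆ Set ι`:
  `0 ≤ sahiE3 (prodBernoulli p) {ω | (v i ∈ ω)ᵢ ∈ U'} A B`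
— Kahn's Conjecture 5 [Kahn, arXiv:2210.08653, Conj. 5] whenever one of the three increasing events is a linear read-once event
in finitely many coordinates (e.g. "`a` open, or `b` open and one of `c, d` open" = `1+23+24`; "`a` open or all of `b, c, d` open";
hitting and principal events).  Proof: `…SahiE3LroSlot.latticeE3_nonneg_of_lro` on the Boolean lattice `Set ι` with the log-modular
product weight `bernoulliWeight p`, whose pattern marginal is the product `∏ᵢ (pᵥᵢ if tᵢ else 1 − pᵥᵢ)` (the law of finitely many
independent coordinates, `Literature…prodBernoulli_real_localCylinder`), and the bridge `Literature…sahiE_three_ind`.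
-/

namespace Summit.CriticalPhenomena.PercolationContinuityZ3.Theorems.SahiE3LroKahn

open Finset MeasureTheory Literature.Combinatorics.Sahi2008 Literature.Probability.Percolation
open Literature.Probability.LatticeModels (prodBernoulli sahiE3 mass latticeE3)

variable {ι : Type*} [Fintype ι]

/-- The `bernoulliWeight`-mass of a pattern fibre `{ω | ∀ i, v i ∈ ω ↔ t i}` is the product
`∏ᵢ (p (v i) if t i else 1 − p (v i))` (independent coordinates). [folklore] -/
theorem mass_bernoulliWeight_fibre (p : ι → unitInterval) {n : ℕ} {v : Fin (n + 1) → ι} (hv : Function.Injective v)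
    (F : Finset (Set ι)) (t : Fin (n + 1) → Bool)
    (hF : ∀ x, x ∈ F ↔ ∀ i, (({v i} : Set ι) ≤ x ↔ t i = true)) :
    mass (bernoulliWeight p) F = ∏ i, (if t i = true then (p (v i) : ℝ) else 1 - (p (v i) : ℝ)) := by
  classical
  -- the fibre is the cylinder on `range v` through `v '' {i | t i}`
  set T : Set ι := {e | ∃ i, v i = e ∧ t i = true} with hT
  have hFC : ∀ x, x ∈ F ↔ x ∈ localCylinder (↑(univ.image v) : Set ι) T := by
    intro x
    rw [hF]
    simp only [localCylinder, Set.mem_setOf_eq, Finset.coe_image, Finset.coe_univ, Set.image_univ, Set.mem_range,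
      forall_exists_index, forall_apply_eq_imp_iff, Set.singleton_subset_iff, hT]
    refine forall_congr' fun i => ?_
    have : (∃ i', v i' = v i ∧ t i' = true) ↔ t i = true :=
      ⟨fun ⟨i', hi', ht'⟩ => hv hi' ▸ ht', fun h => ⟨i, rfl, h⟩⟩
    rw [this]
  have e1 : mass (bernoulliWeight p) F = (prodBernoulli p).real (localCylinder (↑(univ.image v) : Set ι) T) := by
    rw [prodBernoulli_real_eq_sum_weight_ind]
    unfold mass
    rw [← Finset.sum_filter_add_sum_filter_not univ (fun x => x ∈ F)]
    have hz : ∑ x ∈ univ.filter (fun x => ¬ x ∈ F), bernoulliWeight p x * DecisionTree.ind (localCylinder (↑(univ.image v) : Set ι) T) x = 0 :=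
      Finset.sum_eq_zero fun x hx => by
        rw [DecisionTree.ind_of_not_mem (fun h => (Finset.mem_filter.1 hx).2 ((hFC x).2 h)), mul_zero]
    rw [hz, add_zero]
    have hf : univ.filter (fun x => x ∈ F) = F := by ext x; simp
    rw [hf]
    exact Finset.sum_congr rfl fun x hx => by rw [DecisionTree.ind_of_mem ((hFC x).1 hx), mul_one]
  rw [e1, prodBernoulli_real_localCylinder, Finset.prod_image fun a _ b _ h => hv h]
  refine Finset.prod_congr rfl fun i _ => ?_
  have hm : v i ∈ T ↔ t i = true := ⟨fun ⟨i', hi', ht'⟩ => hv hi' ▸ ht', fun h => ⟨i, rfl, h⟩⟩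
  by_cases h : t i = true
  · rw [if_pos (hm.2 h), if_pos h]
  · rw [if_neg (fun hh => h (hm.1 hh)), if_neg h]

open scoped Classical in
/-- **Kahn's Conjecture 5 for every linear read-once first slot.**  `ι` finite, `p : ι → [0,1]`, `v : Fin (n+1) → ι` injective,
`ops : Fin n → Bool` the operators of `x₀ ∘₀ (x₁ ∘₁ (⋯ ∘ₙ₋₁ xₙ))` (`∘ᵢ = ∨` iff `ops i`), `U'` its set of true patterns; then
for ALL increasing `A, B ⊆ Set ι`:  `0 ≤ sahiE3 (prodBernoulli p) {ω | (v i ∈ ω)ᵢ ∈ U'} A B`. [this work] -/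
theorem kahn_of_lro (p : ι → unitInterval) (n : ℕ) (ops : Fin n → Bool) {v : Fin (n + 1) → ι}
    (hv : Function.Injective v) {A B : Set (Set ι)} (hA : IsUpperSet A) (hB : IsUpperSet B)
    (U' : Finset (Fin (n + 1) → Bool))
    (hU' : ∀ t, t ∈ U' ↔ Fin.foldr n (fun i b => bif ops i then (t i.castSucc || b) else (t i.castSucc && b))
      (t (Fin.last n)) = true) :
    0 ≤ sahiE3 (prodBernoulli p) {ω : Set ι | (fun i => decide (v i ∈ ω)) ∈ U'} A B := by
  rw [← sahiE_three_ind]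
  have hμ := isFKGMeasure_bernoulliWeight p
  have hA' : IsUpperSet ((A.toFinset : Finset (Set ι)) : Set (Set ι)) := by simpa using hA
  have hB' : IsUpperSet ((B.toFinset : Finset (Set ι)) : Set (Set ι)) := by simpa using hB
  -- pattern fibres and the product marginal
  have hF : ∀ (t : Fin (n + 1) → Bool) (x : Set ι),
      x ∈ (univ.filter fun x : Set ι => ∀ i, (({v i} : Set ι) ≤ x ↔ t i = true)) ↔
        ∀ i, (({v i} : Set ι) ≤ x ↔ t i = true) := fun t x => by simp
  have hw : ∀ (i : Fin (n + 1)) (b : Bool), 0 ≤ (if b = true then (p (v i) : ℝ) else 1 - (p (v i) : ℝ)) := by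
    intro i b
    split_ifs
    · exact (p (v i)).2.1
    · exact sub_nonneg.2 (p (v i)).2.2
  have key := SahiE3LroSlot.latticeE3_nonneg_of_lro hμ.nonneg hμ.mul_le_mul n ops
    (fun i => SahiE3MajSlot.supPrime_set_singleton (v i)) hF hA' hB'
    (fun i b => if b = true then (p (v i) : ℝ) else 1 - (p (v i) : ℝ)) hw
    (fun t => mass_bernoulliWeight_fibre p hv _ t (hF t)) U' hU'
  rw [← sahiE_three_indicator_eq_latticeE3 hμ.sum_eq_one] at key
  refine le_of_le_of_eq key ?_
  congr 1
  funext i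
  fin_cases i
  · funext ω
    simp [setInd_apply, DecisionTree.ind, Set.singleton_subset_iff]
  · funext ω
    simp [setInd_apply, DecisionTree.ind]
  · funext ω
    simp [setInd_apply, DecisionTree.ind]

end Summit.CriticalPhenomena.PercolationContinuityZ3.Theorems.SahiE3LroKahn
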